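import Literature.MathematicalPhysics.QuantumFieldTheory.Balaban1983to89.Setup
import HarnessLib

/-!
# S2β · D-GUARD ∕ (BG∞) — OSCILLATION ALONG AN AXIS SEGMENT OF A CLOSED BLOCK: a site function whose steps along the bonds of a closed block are `≤ η` moves by
# `≤ n·η` over `n` steps of one axis inside the block ((G7)-lattice brick of UV3-NODE §116.3: the face-oscillation letter of Stage I's midpoint hypothesis and the
# patch-cover letter of Stages T∕S, in the block-data binders of ✓`…ParityBlockPartition` — RULING №127 binder style)

Cell `ym3-torus` (YM ladder rung R3 = continuum `SU(2)` Yang–Mills on the three-torus at fixed lattice data — a RUNG: NOT d = 4, NOT infinite volume,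
NOT a mass gap, NOT Clay).  Width seat «width 19» `ym3-torus-px19` (gen 25, ★p1 lineage), FREE px helper on crux `stmt-QuantumFields-20520`
(`FluctuationComparisonRegPrIntL`; registry `Lines/semiclassical_s2beta.lean` UNTOUCHED, 0∕5); `--kind proof --supports stmt-QuantumFields-20520 --as helper`,
count-neutral, DEFINITION-FREE (0 `def`, 0 `instance`, 0 `notation`, 0 `sorry`, default heartbeats).

WHY.  In the (BG∞) gluing every filling stage reads prescribed data `φ` on faces of a closed block `{x | ∀ κ, (x_κ − s_κ).val ≤ ℓ_κ}` whose steps along face bonds are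
`≤ η` (✓p838762 transition step + lower-stage section steps), and needs its OSCILLATION over a face (Stage I: `d(φ(x), m) ≤ π∕2 + osc` for the midpoint hypothesis of
✓p839248; Stages T∕S: patch radius `osc ≤ r∕2` over patches for ✓p839220's `hpatch`).  The oscillation is the sum of the steps along a monotone lattice path; this
file does ONE AXIS (`n` steps in direction `μ` inside the block: `≤ n·η`), from which faces and boxes follow by the triangle inequality axis by axis.

WHAT IS PROVED (sorry-free; any `[GaugeGroup G]`, any `Params`, any level `j`; `N := P.sitesPerDir j`).
* §1 `val_sub_add_natCast` — offsets add without wrap: `(x_μ − s).val = t`, `t + i < N` ⟹ `((x_μ + i) − s).val = t + i`; `update_add_mem_box` — the shifted site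
  `update x μ (x μ + i)` stays in the closed block while `t + i ≤ ℓ_μ` (`ℓ_μ < N`).
* §2 ★★★ `dist1_axisSegment_le` — if every bond `⟨z, μ⟩` with both ends in the closed block has
  `dist1 (f z·f(z + e_μ)⁻¹) ≤ η`, then for `x` in the block with `μ`-offset `t` and `t + n ≤ ℓ_μ`: `dist1 (f x·(f (update x μ (x μ + n)))⁻¹) ≤ n·η`.

HONEST SCOPE.  `ZMod` offset arithmetic + the triangle inequality of `dist1`; nothing of Bałaban's renormalisation-group analysis is asserted or proved ([Balaban1985RegularSpaces]
Lemma 1 p.79 — the cube-local gauges whose torus-global gluing this serves).  (BG∞) ∕ `hsupp⁺` is a CONJECTURE (plan §116) and is NOT proved; (G7)-lattice and the final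
assembly are OPEN; GAP♯∘ (`stub_uniformFibreGapOrbit`, registry UNTOUCHED), the five registered stubs (0∕5), S2β, 20520, 19936, 19200, `YM3TorusSU2` are NOT proved; no
registered stub is closed; rung R3 — NOT d = 4, NOT infinite volume, NOT a mass gap, NOT Clay; the Yang–Mills mass gap is NOT proved.  Axioms standard.

References: T. Bałaban, CMP **99** (1985) 75–102 [Balaban1985RegularSpaces] (Lemma 1 p.79); CMP **98** (1985) 17–51 [Balaban1985Averaging] ((19)–(20) p.21).
-/

set_option autoImplicit false

namespace Summit.QuantumFields.YangMills.Theorems.FluctuationComparisonRegPrIntLS2BetaBoxOscillation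

open Literature.MathematicalPhysics.QuantumFieldTheory.Balaban1983to89

variable {P : Params} {j : ℕ}

/-! ## §1 Offsets along an axis inside a closed block -/

/-- Offsets add without wrap: `(v − s).val = t`, `t + i < N` ⟹ `((v + i) − s).val = t + i`. [folklore] -/
theorem val_sub_add_natCast {N : ℕ} [NeZero N] (v : ZMod N) (s : ℕ) {t i : ℕ} (ht : (v - (s : ZMod N)).val = t) (hi : t + i < N) :
    (v + (i : ZMod N) - (s : ZMod N)).val = t + i := by
  have hiN : i < N := by omega
  rw [show v + (i : ZMod N) - (s : ZMod N) = (v - (s : ZMod N)) + (i : ZMod N) by ring,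
    ZMod.val_add_of_lt (by rw [ht, ZMod.val_natCast_of_lt hiN]; exact hi), ht, ZMod.val_natCast_of_lt hiN]

/-- The `i`-fold shift in direction `μ` stays in the closed block `{z | ∀ κ, (z_κ − s_κ).val ≤ ℓ_κ}` while `t + i ≤ ℓ_μ` (`t` = the `μ`-offset of `x`, `ℓ_μ < N`).
[folklore] -/
theorem update_add_mem_box (s ℓ : Fin P.d → ℕ) (hℓ : ∀ κ, ℓ κ < P.sitesPerDir j) (x : Site P j)
    (hx : ∀ κ, (x κ - ((s κ : ℕ) : ZMod (P.sitesPerDir j))).val ≤ ℓ κ) (μ : Fin P.d) {t : ℕ}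
    (ht : (x μ - ((s μ : ℕ) : ZMod (P.sitesPerDir j))).val = t) (i : ℕ) (hi : t + i ≤ ℓ μ) (κ : Fin P.d) :
    (Function.update x μ (x μ + (i : ZMod (P.sitesPerDir j))) κ - ((s κ : ℕ) : ZMod (P.sitesPerDir j))).val ≤ ℓ κ := by
  by_cases hκ : κ = μ
  · subst hκ
    rw [Function.update_self, val_sub_add_natCast (x κ) (s κ) ht (lt_of_le_of_lt hi (hℓ κ))]
    exact hi
  · rw [Function.update_of_ne hκ]
    exact hx κ

/-! ## §2 The oscillation along an axis segment -/

/-- ★★★ **OSCILLATION ALONG AN AXIS SEGMENT**: if every bond `⟨z, μ⟩` with `z` and `z + e_μ` in the closed block `{z | ∀ κ, (z_κ − s_κ).val ≤ ℓ_κ}` has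
`dist1 (f z·f(z + e_μ)⁻¹) ≤ η`, then for `x` in the block with `μ`-offset `t` and `t + n ≤ ℓ_μ`, the `n`-fold shift costs `dist1 (f x·(f (x + n e_μ))⁻¹) ≤ n·η`.
[cite: Balaban1985RegularSpaces, Lemma 1 p.79] -/
theorem dist1_axisSegment_le {G : Type*} [GaugeGroup G] (s ℓ : Fin P.d → ℕ) (hℓ : ∀ κ, ℓ κ < P.sitesPerDir j) (f : Site P j → G) (μ : Fin P.d) {η : ℝ}
    (hstep : ∀ z : Site P j, (∀ κ, (z κ - ((s κ : ℕ) : ZMod (P.sitesPerDir j))).val ≤ ℓ κ) →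
      (∀ κ, (Function.update z μ (z μ + 1) κ - ((s κ : ℕ) : ZMod (P.sitesPerDir j))).val ≤ ℓ κ) →
      dist1 (f z * (f (Function.update z μ (z μ + 1)))⁻¹) ≤ η)
    (x : Site P j) (hx : ∀ κ, (x κ - ((s κ : ℕ) : ZMod (P.sitesPerDir j))).val ≤ ℓ κ) {t : ℕ}
    (ht : (x μ - ((s μ : ℕ) : ZMod (P.sitesPerDir j))).val = t) (n : ℕ) (hn : t + n ≤ ℓ μ) :
    dist1 (f x * (f (Function.update x μ (x μ + (n : ZMod (P.sitesPerDir j)))))⁻¹) ≤ n * η := by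
  induction n with
  | zero =>
    have h0 : Function.update x μ (x μ + ((0 : ℕ) : ZMod (P.sitesPerDir j))) = x := by
      rw [Nat.cast_zero, add_zero, Function.update_eq_self]
    rw [h0, mul_inv_cancel, GaugeGroup.dist1_one, Nat.cast_zero, zero_mul]
  | succ n ih =>
    have hn' : t + n ≤ ℓ μ := by omega
    -- the `n`-fold shift `y` is in the block, its `μ`-offset is `t + n`, and `y + e_μ` is the `(n+1)`-fold shift
    set y : Site P j := Function.update x μ (x μ + (n : ZMod (P.sitesPerDir j))) with hy
    have hymem : ∀ κ, (y κ - ((s κ : ℕ) : ZMod (P.sitesPerDir j))).val ≤ ℓ κ := update_add_mem_box s ℓ hℓ x hx μ ht n hn'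
    have hyμ : y μ = x μ + (n : ZMod (P.sitesPerDir j)) := by rw [hy, Function.update_self]
    have hsucc : Function.update y μ (y μ + 1) = Function.update x μ (x μ + ((n + 1 : ℕ) : ZMod (P.sitesPerDir j))) := by
      rw [hyμ, hy, Function.update_idem]
      push_cast
      rw [add_assoc]
    have hsmem : ∀ κ, (Function.update y μ (y μ + 1) κ - ((s κ : ℕ) : ZMod (P.sitesPerDir j))).val ≤ ℓ κ := by
      rw [hsucc]
      exact update_add_mem_box s ℓ hℓ x hx μ ht (n + 1) hn
    have hst := hstep y hymem hsmem
    rw [hsucc] at hst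
    -- triangle `dist1 (A C⁻¹) ≤ dist1 (A B⁻¹) + dist1 (B C⁻¹)` (✓`…ConeFilling.dist1_mul_inv_le_via`, inlined to keep this file's imports at `Setup`)
    have htri : ∀ A B C : G, dist1 (A * C⁻¹) ≤ dist1 (A * B⁻¹) + dist1 (B * C⁻¹) := fun A B C => by
      have e : A * C⁻¹ = A * B⁻¹ * (B * C⁻¹) := by group
      rw [e]; exact GaugeGroup.dist1_mul_le _ _
    calc dist1 (f x * (f (Function.update x μ (x μ + ((n + 1 : ℕ) : ZMod (P.sitesPerDir j)))))⁻¹)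
        ≤ dist1 (f x * (f y)⁻¹) + dist1 (f y * (f (Function.update x μ (x μ + ((n + 1 : ℕ) : ZMod (P.sitesPerDir j)))))⁻¹) :=
          htri _ _ _
      _ ≤ n * η + η := add_le_add (ih hn') hst
      _ = ((n + 1 : ℕ) : ℝ) * η := by push_cast; ring

end Summit.QuantumFields.YangMills.Theorems.FluctuationComparisonRegPrIntLS2BetaBoxOscillation
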